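import Literature.NumberTheory.Multiplicative.SquarefreeDensity
import Literature.NumberTheory.Multiplicative.SigmaTotientAverageOrder
import Mathlib.NumberTheory.Harmonic.Bounds
import Mathlib.Analysis.SpecialFunctions.Log.Monotone
import HarnessLib

/-!
# The logarithmic sums over squarefree numbers and over `2^{ω(n)}` with their TRUE leading constants:
# `Σ_{n ≤ N, n squarefree} 1/n ≤ (6/π²) log N + 22` and `Σ_{n ≤ N} 2^{ω(n)}/n ≤ (3/π²) log²N + 23 log N + 45`

Topic `Literature/NumberTheory/Multiplicative` (namespace
`Literature.NumberTheory.Multiplicative.SquarefreeHarmonic`). Everything in this file is PROVED (theorems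
only; no definition, no named fact).

Montgomery–Vaughan, *Multiplicative Number Theory I*, §2.1: Theorem 2.2 (`Q(x) = (6/π²)x + O(√x)` for the
number `Q(x)` of squarefree `n ≤ x`; in the tree with the explicit constant `5√(x+1)`, Hardy–Wright Thm 333,
`Literature.NumberTheory.Multiplicative.SquarefreeDensity.thm333`) and §2.1.1 Exercise 15 (b) (cf. Grosswald
1956, Bateman 1957): "`Σ_{n ≤ x} 2^{ω(n)} = (6/π²) x log x + cx + O(x^{1/2} log x)`". By partial summation
these give `Σ_{n ≤ x} μ²(n)/n = (6/π²) log x + O(1)` and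
`Σ_{n ≤ x} 2^{ω(n)}/n = (3/π²)(log x)² + O(log x)` — the second is the estimate quoted as Lemma 5 of
Ralaivaosaona–Razakarinoro (J. Number Theory 281 (2026), p. 817: "`Σ_{n ≤ y} 2^{w(n)}/n = (3/π²)(log y)²
+ O(log y)`", citing Montgomery–Vaughan) in the proof of their Theorem 2, the consumer of this file
(`Literature/NumberTheory/LFunctions/RealZeroRepulsionOddLogClassNumberSharp.lean`).

Here only the UPPER bounds are filed, with explicit (generous) secondary constants and the exact leading
constants `6/π²` and `3/π²`:

* `sum_div_eq_abel` — the summation by parts identity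
  `Σ_{m ≤ N} f(m)/m = S(N)/(N+1) + Σ_{n ≤ N} S(n)/(n(n+1))`, `S(n) = Σ_{m ≤ n} f(m)`;
  `sum_mul_sub_eq_abel` — `Σ_{x ≤ N} a(x)(F(N) − F(x)) = Σ_{n < N} A(n)(F(n+1) − F(n))`;
* (private) `sum_inv_mul_sqrt_le_three` — `Σ_{n ≤ N} 1/(n√(n+1)) ≤ 3`; `sum_log_div_le` —
  `Σ_{n ≤ N} log n/n ≤ ½ log²N + 1` (mean value theorem on `½ log²`, `log x/x` decreasing beyond `e`);
* `sum_squarefree_inv_le` — **`Σ_{n ≤ N, n squarefree} 1/n ≤ (6/π²) log N + 22`** (`N ≥ 1`);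
* `sum_two_pow_omega_div_eq` — `Σ_{n ≤ N} 2^{ω(n)}/n = Σ_{x ≤ N, x squarefree} H(⌊N/x⌋)/x`
  (`2^{ω(n)} = #{d ∣ n : d squarefree}`, hyperbola fibration);
* `sum_two_pow_omega_div_le` — **`Σ_{n ≤ N} 2^{ω(n)}/n ≤ (3/π²)(log N)² + 23 log N + 45`** (`N ≥ 1`),
  `ω(n) = #(n.primeFactors)`.

## References

* [MontgomeryVaughan2007] H. L. Montgomery, R. C. Vaughan, *Multiplicative Number Theory I*, CUP 2007, §2.1
  Theorem 2.2; §2.1.1 Exercise 15 (b).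
* [HardyWright2008] Thm 333 (the count of squarefree numbers; tree `SquarefreeDensity.thm333`).
* [Apostol1976] T. M. Apostol, *Introduction to Analytic Number Theory*, Springer 1976, Theorem 4.2 (Abel's
  identity; here in finite-difference form).
* [RalaivaosaonaRazakarinoro2026] Lemma 5 (p. 817), the consumer.
-/

open Finset Real

namespace Literature.NumberTheory.Multiplicative.SquarefreeHarmonic

/-! ### Two summation-by-parts identities -/

/-- **Summation by parts, harmonic weights**: `Σ_{m=1}^{N} f(m)/m = S(N)/(N+1) + Σ_{n=1}^{N} S(n)/(n(n+1))`
with `S(n) = Σ_{m=1}^{n} f(m)` (because `1/m = 1/(N+1) + Σ_{n=m}^{N} 1/(n(n+1))`): Abel's identity in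
finite-difference form. [cite: Apostol1976, Theorem 4.2 (Abel's identity), finite-difference form] -/
theorem sum_div_eq_abel (f : ℕ → ℝ) (N : ℕ) :
    ∑ m ∈ Icc 1 N, f m / m =
      (∑ m ∈ Icc 1 N, f m) / ((N : ℝ) + 1) +
        ∑ n ∈ Icc 1 N, (∑ m ∈ Icc 1 n, f m) / ((n : ℝ) * ((n : ℝ) + 1)) := by
  induction N with
  | zero => simp
  | succ N ih =>
    have e1 : ∑ m ∈ Icc 1 (N + 1), f m / (m : ℝ) =
        ∑ m ∈ Icc 1 N, f m / (m : ℝ) + f (N + 1) / ((N + 1 : ℕ) : ℝ) :=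
      Finset.sum_Icc_succ_top (by omega) (fun m => f m / (m : ℝ))
    have e2 : ∑ m ∈ Icc 1 (N + 1), f m = ∑ m ∈ Icc 1 N, f m + f (N + 1) :=
      Finset.sum_Icc_succ_top (by omega) f
    have e3 : ∑ n ∈ Icc 1 (N + 1), (∑ m ∈ Icc 1 n, f m) / ((n : ℝ) * ((n : ℝ) + 1)) =
        ∑ n ∈ Icc 1 N, (∑ m ∈ Icc 1 n, f m) / ((n : ℝ) * ((n : ℝ) + 1)) +
          (∑ m ∈ Icc 1 (N + 1), f m) / (((N + 1 : ℕ) : ℝ) * (((N + 1 : ℕ) : ℝ) + 1)) :=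
      Finset.sum_Icc_succ_top (by omega) (fun n => (∑ m ∈ Icc 1 n, f m) / ((n : ℝ) * ((n : ℝ) + 1)))
    rw [e1, e3, e2, ih]
    set S : ℝ := ∑ m ∈ Icc 1 N, f m
    have hN1 : (0 : ℝ) < (N : ℝ) + 1 := by positivity
    have hN2 : (0 : ℝ) < (N : ℝ) + 1 + 1 := by positivity
    push_cast
    field_simp
    ring

/-- **Summation by parts, differences**: `Σ_{x=1}^{N} a(x)(F(N) − F(x)) = Σ_{n=1}^{N−1} A(n)(F(n+1) − F(n))`
with `A(n) = Σ_{x=1}^{n} a(x)` (written with `Finset.Ico 1 N` for `1 ≤ n < N`): Abel's identity in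
finite-difference form. [cite: Apostol1976, Theorem 4.2 (Abel's identity), finite-difference form] -/
theorem sum_mul_sub_eq_abel (a : ℕ → ℝ) (F : ℕ → ℝ) (N : ℕ) :
    ∑ x ∈ Icc 1 N, a x * (F N - F x) =
      ∑ n ∈ Ico 1 N, (∑ x ∈ Icc 1 n, a x) * (F (n + 1) - F n) := by
  induction N with
  | zero => simp
  | succ N ih =>
    rcases Nat.eq_zero_or_pos N with rfl | hN
    · simp
    have hI : Icc 1 (N + 1) = insert (N + 1) (Icc 1 N) := by
      ext m; simp only [mem_Icc, mem_insert]; omega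
    have hnot : N + 1 ∉ Icc 1 N := by simp
    have hJ : Ico 1 (N + 1) = insert N (Ico 1 N) := by
      ext m; simp only [mem_Ico, mem_insert]; omega
    have hnot' : N ∉ Ico 1 N := by simp
    rw [hI, sum_insert hnot, hJ, sum_insert hnot', ← ih, sub_self, mul_zero, zero_add]
    have : ∀ x ∈ Icc 1 N, a x * (F (N + 1) - F x) = a x * (F N - F x) + a x * (F (N + 1) - F N) := by
      intro x _; ring
    rw [sum_congr rfl this, sum_add_distrib, ← sum_mul]
    ring

/-! ### Two elementary numerical sums -/

/-- `1/((n+1)√(n+1)) ≤ 2(1/√n − 1/√(n+1))` for `n ≥ 1`. [folklore] -/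
private theorem inv_mul_sqrt_le_telescope {n : ℕ} (hn : 1 ≤ n) :
    1 / (((n : ℝ) + 1) * Real.sqrt ((n : ℝ) + 1)) ≤
      2 * (1 / Real.sqrt n - 1 / Real.sqrt ((n : ℝ) + 1)) := by
  have hn1 : (1 : ℝ) ≤ n := by exact_mod_cast hn
  set s := Real.sqrt ((n : ℝ) + 1) with hs
  set t := Real.sqrt (n : ℝ) with ht
  have ht1 : 1 ≤ t := by rw [ht]; exact Real.one_le_sqrt.mpr hn1
  have ht0 : 0 < t := by linarith
  have hs2 : s ^ 2 = (n : ℝ) + 1 := by rw [hs]; exact Real.sq_sqrt (by positivity)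
  have ht2 : t ^ 2 = (n : ℝ) := by rw [ht]; exact Real.sq_sqrt (by positivity)
  have hts : t ≤ s := by rw [hs, ht]; exact Real.sqrt_le_sqrt (by linarith)
  have hs0 : 0 < s := by linarith
  rw [show ((n : ℝ) + 1) = s ^ 2 from hs2.symm]
  have h1 : s * s - t * t = 1 := by nlinarith
  -- `t ≤ 2 s²(s − t)` since `2s²(s − t) − t = (s − t)²(2s + t)` (using `s² − t² = 1`)
  have key : t ≤ 2 * (s - t) * s ^ 2 := by
    nlinarith [mul_nonneg (mul_nonneg (sub_nonneg.2 hts) (sub_nonneg.2 hts)) (show (0 : ℝ) ≤ 2 * s + t by positivity)]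
  rw [div_sub_div _ _ ht0.ne' hs0.ne', one_mul, mul_one, ← mul_div_assoc,
    div_le_div_iff₀ (by positivity) (by positivity), one_mul]
  nlinarith [mul_le_mul_of_nonneg_right key hs0.le]

/-- **`Σ_{n=1}^{N} 1/(n√(n+1)) ≤ 3`.** [folklore] -/
private theorem sum_inv_mul_sqrt_le_three (N : ℕ) :
    ∑ n ∈ Icc 1 N, 1 / ((n : ℝ) * Real.sqrt ((n : ℝ) + 1)) ≤ 3 := by
  rcases Nat.eq_zero_or_pos N with rfl | hN
  · simp
  -- the term `n = 1` is `1/√2 ≤ 1`; for `n ≥ 2` compare with `1/(n√n)` and telescope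
  have hI : Icc 1 N = insert 1 (Icc 2 N) := by
    ext m; simp only [mem_Icc, mem_insert]; omega
  rw [hI, sum_insert (by simp)]
  have hfirst : 1 / (((1 : ℕ) : ℝ) * Real.sqrt (((1 : ℕ) : ℝ) + 1)) ≤ 1 := by
    have h2 : (1 : ℝ) ≤ Real.sqrt 2 := Real.one_le_sqrt.mpr (by norm_num)
    have e : ((1 : ℕ) : ℝ) * Real.sqrt (((1 : ℕ) : ℝ) + 1) = Real.sqrt 2 := by norm_num
    rw [e, div_le_one (by positivity)]
    exact h2
  have hterm : ∀ n ∈ Icc 2 N, 1 / ((n : ℝ) * Real.sqrt ((n : ℝ) + 1)) ≤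
      2 * (1 / Real.sqrt ((n : ℝ) - 1) - 1 / Real.sqrt n) := by
    intro n hn
    rw [mem_Icc] at hn
    obtain ⟨m, rfl⟩ : ∃ m, n = m + 1 := ⟨n - 1, by omega⟩
    have hm : 1 ≤ m := by omega
    have h := inv_mul_sqrt_le_telescope hm
    push_cast
    rw [show (m : ℝ) + 1 - 1 = m by ring]
    refine le_trans ?_ h
    -- `1/((m+1)√(m+2)) ≤ 1/((m+1)√(m+1))`
    have hsq : Real.sqrt ((m : ℝ) + 1) ≤ Real.sqrt ((m : ℝ) + 1 + 1) := Real.sqrt_le_sqrt (by linarith)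
    have hpos : 0 < Real.sqrt ((m : ℝ) + 1) := Real.sqrt_pos.mpr (by positivity)
    exact one_div_le_one_div_of_le (by positivity) (by gcongr)
  -- exact telescoping
  have hexact : ∀ K : ℕ, 1 ≤ K → ∑ n ∈ Icc 2 K, (1 / Real.sqrt ((n : ℝ) - 1) - 1 / Real.sqrt n) =
      1 - 1 / Real.sqrt K := by
    intro K hK
    induction K with
    | zero => omega
    | succ K ihK =>
      rcases Nat.eq_zero_or_pos K with rfl | hK0
      · simp
      rw [Finset.sum_Icc_succ_top (by omega) (fun n : ℕ => 1 / Real.sqrt ((n : ℝ) - 1) - 1 / Real.sqrt n),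
        ihK hK0]
      push_cast
      ring
  have hrest : ∑ n ∈ Icc 2 N, 1 / ((n : ℝ) * Real.sqrt ((n : ℝ) + 1)) ≤ 2 * (1 - 1 / Real.sqrt N) := by
    refine (sum_le_sum hterm).trans ?_
    rw [← mul_sum, hexact N hN]
  have hsN : 0 < Real.sqrt (N : ℝ) := Real.sqrt_pos.mpr (by exact_mod_cast hN)
  have : 0 < 1 / Real.sqrt (N : ℝ) := by positivity
  linarith

/-- `log n/n ≤ ½ log²n − ½ log²(n−1)` for `n ≥ 4` (mean value theorem; `log x/x` is decreasing on `[e, ∞)`).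
[folklore] -/
private theorem log_div_le_half_sq_sub {n : ℕ} (hn : 4 ≤ n) :
    Real.log n / n ≤ Real.log n ^ 2 / 2 - Real.log ((n : ℝ) - 1) ^ 2 / 2 := by
  have hn4 : (4 : ℝ) ≤ n := by exact_mod_cast hn
  set a : ℝ := (n : ℝ) - 1 with ha
  have ha3 : 3 ≤ a := by rw [ha]; linarith
  have hab : a < n := by rw [ha]; linarith
  -- MVT for `g(x) = (log x)(log x)/2` on `[a, n]`
  have hsub' : Set.Icc a n ⊆ {0}ᶜ := by
    intro x hx
    simp only [Set.mem_Icc] at hx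
    simp only [Set.mem_compl_iff, Set.mem_singleton_iff]
    linarith
  have hcont : ContinuousOn (fun x : ℝ => Real.log x * Real.log x / 2) (Set.Icc a n) :=
    ((Real.continuousOn_log.mono hsub').mul (Real.continuousOn_log.mono hsub')).div_const 2
  have hderiv : ∀ x ∈ Set.Ioo a n,
      HasDerivAt (fun x : ℝ => Real.log x * Real.log x / 2) (Real.log x / x) x := by
    intro x hx
    simp only [Set.mem_Ioo] at hx
    have hx0 : x ≠ 0 := by linarith
    have h := ((Real.hasDerivAt_log hx0).mul (Real.hasDerivAt_log hx0)).div_const 2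
    refine h.congr_deriv ?_
    field_simp
    ring
  obtain ⟨c, hc, hcslope⟩ := exists_hasDerivAt_eq_slope (fun x : ℝ => Real.log x * Real.log x / 2)
    (fun x => Real.log x / x) hab hcont hderiv
  simp only [Set.mem_Ioo] at hc
  have hsub : (n : ℝ) - a = 1 := by rw [ha]; ring
  rw [hsub, div_one] at hcslope
  -- `log n/n ≤ log c/c` since `e ≤ c ≤ n`
  have he : Real.exp 1 ≤ c := by
    have := Real.exp_one_lt_d9
    linarith
  have hmono := Real.log_div_self_antitoneOn he (le_trans he hc.2.le) hc.2.le
  simp only at hmono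
  rw [pow_two, pow_two]
  linarith

/-- **`Σ_{n=1}^{N} log n/n ≤ ½ (log N)² + 1`.** [folklore] -/
private theorem sum_log_div_le (N : ℕ) :
    ∑ n ∈ Icc 1 N, Real.log n / n ≤ Real.log N ^ 2 / 2 + 1 := by
  -- the terms `n ≤ 3` contribute `log 2/2 + log 3/3 ≤ 1`; the rest telescopes
  have hlog2 : Real.log 2 < 0.6931471808 := Real.log_two_lt_d9
  have hlog3 : Real.log 3 ≤ Real.log 2 + 1 / 2 := by
    have h32 : Real.log 3 = Real.log 2 + Real.log (3 / 2) := by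
      rw [← Real.log_mul (by norm_num) (by norm_num)]; norm_num
    have hle : Real.log (3 / 2 : ℝ) ≤ 3 / 2 - 1 := Real.log_le_sub_one_of_pos (by norm_num)
    rw [h32]; linarith
  have hsmall : ∑ n ∈ Icc 1 3, Real.log (n : ℕ) / (n : ℕ) ≤ (1 : ℝ) := by
    rw [show Icc 1 3 = {1, 2, 3} by decide, sum_insert (by decide), sum_insert (by decide), sum_singleton]
    push_cast
    rw [Real.log_one]
    nlinarith
  have hnonneg : ∀ n ∈ Icc 1 N, 0 ≤ Real.log (n : ℕ) / (n : ℕ) := by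
    intro n hn
    rw [mem_Icc] at hn
    have : 0 ≤ Real.log n := Real.log_nonneg (by exact_mod_cast hn.1)
    positivity
  have hlogN : 0 ≤ Real.log N ^ 2 / 2 := by positivity
  rcases Nat.lt_or_ge N 4 with hN | hN
  · -- small `N`: the sum is at most the sum up to `3`
    have hsub : Icc 1 N ⊆ Icc 1 3 := fun n hn => by
      rw [mem_Icc] at hn ⊢; omega
    have h : ∑ n ∈ Icc 1 N, Real.log (n : ℕ) / (n : ℕ) ≤ ∑ n ∈ Icc 1 3, Real.log (n : ℕ) / (n : ℕ) :=
      sum_le_sum_of_subset_of_nonneg hsub fun n hn _ => by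
        rw [mem_Icc] at hn
        have : 0 ≤ Real.log n := Real.log_nonneg (by exact_mod_cast hn.1)
        positivity
    linarith
  · have hsplit : Icc 1 N = Icc 1 3 ∪ Icc 4 N := by
      ext m; simp only [mem_Icc, mem_union]; omega
    have hdisj : Disjoint (Icc 1 3) (Icc 4 N) := by
      rw [disjoint_left]; intro m hm hm'; simp only [mem_Icc] at hm hm'; omega
    rw [hsplit, sum_union hdisj]
    have hbig : ∑ n ∈ Icc 4 N, Real.log (n : ℕ) / (n : ℕ) ≤
        Real.log N ^ 2 / 2 - Real.log 3 ^ 2 / 2 := by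
      have hle := sum_le_sum (s := Icc 4 N) fun n hn => log_div_le_half_sq_sub (mem_Icc.mp hn).1
      refine hle.trans ?_
      -- telescoping sum
      have htel : ∀ M : ℕ, 4 ≤ M → ∑ n ∈ Icc 4 M, (Real.log n ^ 2 / 2 - Real.log ((n : ℝ) - 1) ^ 2 / 2) =
          Real.log M ^ 2 / 2 - Real.log 3 ^ 2 / 2 := by
        intro M hM
        induction M with
        | zero => omega
        | succ M ih =>
          rcases Nat.lt_or_ge M 4 with hM4 | hM4
          · have hM3 : M = 3 := by omega
            subst hM3
            rw [show Icc 4 (3 + 1) = {4} by decide, sum_singleton]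
            push_cast
            norm_num
          rw [Finset.sum_Icc_succ_top (by omega)
            (fun n : ℕ => Real.log n ^ 2 / 2 - Real.log ((n : ℝ) - 1) ^ 2 / 2), ih hM4]
          push_cast
          ring
      rw [htel N hN]
    have h3 : 0 ≤ Real.log 3 ^ 2 / 2 := by positivity
    linarith

/-! ### The squarefree harmonic sum -/

/-- `log(N+1) ≤ log N + 1` for `N ≥ 1`. [folklore] -/
private theorem log_succ_le {N : ℕ} (hN : 1 ≤ N) : Real.log ((N : ℝ) + 1) ≤ Real.log N + 1 := by
  have hN1 : (1 : ℝ) ≤ N := by exact_mod_cast hN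
  have h := Real.log_le_sub_one_of_pos (show (0 : ℝ) < ((N : ℝ) + 1) / N by positivity)
  rw [Real.log_div (by positivity) (by positivity)] at h
  have : ((N : ℝ) + 1) / N - 1 = 1 / N := by field_simp; ring
  rw [this] at h
  have h1 : 1 / (N : ℝ) ≤ 1 := by rw [div_le_one (by positivity)]; exact hN1
  linarith

/-- `Σ_{n=1}^{N} 1/(n+1) ≤ log(N+1)`. [folklore] -/
private theorem sum_inv_succ_le_log (N : ℕ) :
    ∑ n ∈ Icc 1 N, 1 / ((n : ℝ) + 1) ≤ Real.log ((N : ℝ) + 1) := by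
  -- `1/(n+1) ≤ log(n+1) − log n`
  have hterm : ∀ n ∈ Icc 1 N, 1 / ((n : ℝ) + 1) ≤ Real.log ((n : ℝ) + 1) - Real.log n := by
    intro n hn
    rw [mem_Icc] at hn
    have hn0 : (0 : ℝ) < n := by exact_mod_cast hn.1
    have h := Real.log_le_sub_one_of_pos (show (0 : ℝ) < (n : ℝ) / ((n : ℝ) + 1) by positivity)
    rw [Real.log_div hn0.ne' (by positivity)] at h
    have : (n : ℝ) / ((n : ℝ) + 1) - 1 = -(1 / ((n : ℝ) + 1)) := by field_simp; ring
    rw [this] at h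
    linarith
  refine (sum_le_sum hterm).trans ?_
  have htel : ∀ M : ℕ, ∑ n ∈ Icc 1 M, (Real.log ((n : ℝ) + 1) - Real.log n) = Real.log ((M : ℝ) + 1) := by
    intro M
    induction M with
    | zero => simp
    | succ M ih =>
      have hI : Icc 1 (M + 1) = insert (M + 1) (Icc 1 M) := by
        ext m; simp only [mem_Icc, mem_insert]; omega
      rw [hI, sum_insert (by simp), ih]
      push_cast
      ring
  rw [htel N]

/-- **`Σ_{n ≤ N, n squarefree} 1/n ≤ (6/π²) log N + 22`** (`N ≥ 1`), from `Q(x) = (6/π²)x + O(√x)` by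
summation by parts. [cite: MontgomeryVaughan2007, §2.1 Theorem 2.2] [cite: HardyWright2008, Thm 333] -/
theorem sum_squarefree_inv_le {N : ℕ} (hN : 1 ≤ N) :
    ∑ n ∈ (Icc 1 N).filter Squarefree, (1 : ℝ) / n ≤ 6 / Real.pi ^ 2 * Real.log N + 22 := by
  classical
  set f : ℕ → ℝ := fun n => if Squarefree n then 1 else 0 with hf
  have hsum : ∑ n ∈ (Icc 1 N).filter Squarefree, (1 : ℝ) / n = ∑ n ∈ Icc 1 N, f n / n := by
    rw [sum_filter]
    refine sum_congr rfl fun n _ => ?_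
    simp only [hf]
    split_ifs <;> simp
  rw [hsum, sum_div_eq_abel f N]
  -- `S(n) = Q(n)` and `Q(n) ≤ 6n/π² + 5√(n+1)`
  have hQ : ∀ n : ℕ, ∑ m ∈ Icc 1 n, f m = (((Icc 1 n).filter Squarefree).card : ℝ) := by
    intro n
    rw [natCast_card_filter]
  have hQle : ∀ n : ℕ, ∑ m ∈ Icc 1 n, f m ≤ 6 * n / Real.pi ^ 2 + 5 * Real.sqrt ((n : ℝ) + 1) := by
    intro n
    rw [hQ]
    have h := SquarefreeDensity.thm333 n
    have := (abs_le.mp h).2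
    linarith
  have hπ : 0 < Real.pi ^ 2 := by positivity
  have hπ9 : 9 < Real.pi ^ 2 := by have := Real.pi_gt_three; nlinarith
  have hc : 6 / Real.pi ^ 2 < 1 := by rw [div_lt_one hπ]; linarith
  have hc0 : 0 < 6 / Real.pi ^ 2 := by positivity
  -- first term: `Q(N)/(N+1) ≤ 6/π² + 5/√(N+1) ≤ 6`
  have hN0 : (0 : ℝ) < N := by exact_mod_cast hN
  have h1 : (∑ m ∈ Icc 1 N, f m) / ((N : ℝ) + 1) ≤ 6 := by
    rw [div_le_iff₀ (by positivity)]
    refine (hQle N).trans ?_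
    have hs : Real.sqrt ((N : ℝ) + 1) ≤ (N : ℝ) + 1 := by
      rw [Real.sqrt_le_left (by positivity)]
      nlinarith
    have : 6 * (N : ℝ) / Real.pi ^ 2 ≤ N := by
      rw [div_le_iff₀ hπ]; nlinarith
    linarith
  -- second term: `Σ Q(n)/(n(n+1)) ≤ (6/π²) Σ 1/(n+1) + 5 Σ 1/(n√(n+1))`
  have h2 : ∑ n ∈ Icc 1 N, (∑ m ∈ Icc 1 n, f m) / ((n : ℝ) * ((n : ℝ) + 1)) ≤
      6 / Real.pi ^ 2 * ∑ n ∈ Icc 1 N, 1 / ((n : ℝ) + 1) +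
        5 * ∑ n ∈ Icc 1 N, 1 / ((n : ℝ) * Real.sqrt ((n : ℝ) + 1)) := by
    rw [mul_sum, mul_sum, ← sum_add_distrib]
    refine sum_le_sum fun n hn => ?_
    rw [mem_Icc] at hn
    have hn0 : (0 : ℝ) < n := by exact_mod_cast hn.1
    have hden : (0 : ℝ) < (n : ℝ) * ((n : ℝ) + 1) := by positivity
    calc (∑ m ∈ Icc 1 n, f m) / ((n : ℝ) * ((n : ℝ) + 1))
        ≤ (6 * n / Real.pi ^ 2 + 5 * Real.sqrt ((n : ℝ) + 1)) / ((n : ℝ) * ((n : ℝ) + 1)) :=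
          div_le_div_of_nonneg_right (hQle n) hden.le
      _ = 6 / Real.pi ^ 2 * (1 / ((n : ℝ) + 1)) +
            5 * (1 / ((n : ℝ) * Real.sqrt ((n : ℝ) + 1))) := by
          have hsq : Real.sqrt ((n : ℝ) + 1) ≠ 0 := (Real.sqrt_pos.mpr (by positivity)).ne'
          have hsq2 : Real.sqrt ((n : ℝ) + 1) ^ 2 = (n : ℝ) + 1 := Real.sq_sqrt (by positivity)
          field_simp
          nlinarith [hsq2]
  have h3 := sum_inv_succ_le_log N
  have h4 := sum_inv_mul_sqrt_le_three N
  have h5 := log_succ_le hN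
  have hlogN : 0 ≤ Real.log N := Real.log_nonneg (by exact_mod_cast hN)
  nlinarith [mul_le_mul_of_nonneg_left (h3.trans h5) hc0.le]

/-! ### `2^{ω(n)}` as the number of squarefree divisors, and the hyperbola fibration -/

/-- `#{d ∣ n : d squarefree} = 2^{ω(n)}` (`n ≠ 0`; the squarefree divisors correspond to the subsets of the
prime factors). [folklore] -/
private theorem card_filter_squarefree_divisors {n : ℕ} (hn : n ≠ 0) :
    ({d ∈ n.divisors | Squarefree d} : Finset ℕ).card = 2 ^ n.primeFactors.card := by
  have h := Nat.divisors_filter_squarefree hn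
  rw [Finset.card_def, h, Multiset.card_map, ← Finset.card_def, Finset.card_powerset, Nat.factors_eq]
  rfl

/-- **`Σ_{n ≤ N} 2^{ω(n)}/n = Σ_{x ≤ N, x squarefree} H(⌊N/x⌋)/x`** (`2^{ω(n)} = Σ_{x ∣ n} μ²(x)`, then the
lattice points under the hyperbola fibred by `x`). [cite: MontgomeryVaughan2007, §2.1.1 Exercise 15] -/
theorem sum_two_pow_omega_div_eq (N : ℕ) :
    ∑ n ∈ Icc 1 N, (2 : ℝ) ^ n.primeFactors.card / n =
      ∑ x ∈ Icc 1 N, (if Squarefree x then (1 : ℝ) else 0) / x * (harmonic (N / x) : ℝ) := by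
  classical
  have h := AverageOrder.sum_Icc_sum_divisors_mul (fun x => (if Squarefree x then (1 : ℝ) else 0) / x)
    (fun y => 1 / (y : ℝ)) N
  have hR : ∀ x ∈ Icc 1 N, (if Squarefree x then (1 : ℝ) else 0) / x * ∑ y ∈ Icc 1 (N / x), 1 / (y : ℝ) =
      (if Squarefree x then (1 : ℝ) else 0) / x * (harmonic (N / x) : ℝ) := by
    intro x _
    rw [AverageOrder.harmonic_eq_sum_Icc_real]
  rw [sum_congr rfl hR] at h
  rw [← h]
  refine sum_congr rfl fun n hn => ?_
  rw [mem_Icc] at hn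
  have hn0 : n ≠ 0 := by omega
  have hn0' : (0 : ℝ) < n := by exact_mod_cast hn.1
  -- `Σ_{x ∣ n} 𝟙(x)/x · 1/(n/x) = #{x ∣ n squarefree}/n`
  have hterm : ∀ x ∈ n.divisors, (if Squarefree x then (1 : ℝ) else 0) / x * (1 / ((n / x : ℕ) : ℝ)) =
      (if Squarefree x then (1 : ℝ) else 0) / n := by
    intro x hx
    have hxd : x ∣ n := Nat.dvd_of_mem_divisors hx
    have hx0 : 0 < x := Nat.pos_of_mem_divisors hx
    have hx0' : (0 : ℝ) < x := by exact_mod_cast hx0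
    have hcast : ((n / x : ℕ) : ℝ) = (n : ℝ) / x := by
      rw [Nat.cast_div hxd hx0'.ne']
    rw [hcast]
    have hnx : (0 : ℝ) < (n : ℝ) / x := by positivity
    field_simp
  rw [sum_congr rfl hterm, ← sum_div, ← sum_filter, sum_const, nsmul_eq_mul, mul_one,
    card_filter_squarefree_divisors hn0]
  push_cast
  ring

/-- **`Σ_{n ≤ N} 2^{ω(n)}/n ≤ (3/π²)(log N)² + 23 log N + 45`** (`N ≥ 1`): from the fibration,
`H(⌊N/x⌋) ≤ 1 + log N − log x`, summation by parts against `log`, the squarefree harmonic sum and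
`Σ log n/n ≤ ½ log²N + 1`. [cite: MontgomeryVaughan2007, §2.1.1 Exercise 15 (b)]
[cite: RalaivaosaonaRazakarinoro2026, Lemma 5] -/
theorem sum_two_pow_omega_div_le {N : ℕ} (hN : 1 ≤ N) :
    ∑ n ∈ Icc 1 N, (2 : ℝ) ^ n.primeFactors.card / n ≤
      3 / Real.pi ^ 2 * Real.log N ^ 2 + 23 * Real.log N + 45 := by
  classical
  rw [sum_two_pow_omega_div_eq]
  set a : ℕ → ℝ := fun x => (if Squarefree x then (1 : ℝ) else 0) / x with ha
  have ha0 : ∀ x, 0 ≤ a x := fun x => by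
    simp only [ha]; split_ifs <;> positivity
  have hN0 : (0 : ℝ) < N := by exact_mod_cast hN
  have hlogN : 0 ≤ Real.log N := Real.log_nonneg (by exact_mod_cast hN)
  -- the squarefree harmonic sums `A(n) = Σ_{x ≤ n} a(x) ≤ (6/π²) log n + 22`
  have hA : ∀ n : ℕ, 1 ≤ n → ∑ x ∈ Icc 1 n, a x ≤ 6 / Real.pi ^ 2 * Real.log n + 22 := by
    intro n hn
    have h := sum_squarefree_inv_le hn
    rw [sum_filter] at h
    convert h using 2 with x _
    simp only [ha]; split_ifs <;> simp
  -- step 1: `H(⌊N/x⌋) ≤ 1 + log N − log x`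
  have hstep1 : ∑ x ∈ Icc 1 N, a x * (harmonic (N / x) : ℝ) ≤
      ∑ x ∈ Icc 1 N, a x * (1 + (Real.log N - Real.log x)) := by
    refine sum_le_sum fun x hx => mul_le_mul_of_nonneg_left ?_ (ha0 x)
    rw [mem_Icc] at hx
    have hx0 : (0 : ℝ) < x := by exact_mod_cast hx.1
    have hq : 1 ≤ N / x := (Nat.le_div_iff_mul_le hx.1).mpr (by simpa using hx.2)
    have hq0 : (0 : ℝ) < ((N / x : ℕ) : ℝ) := by exact_mod_cast hq
    have h1 := harmonic_le_one_add_log (N / x)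
    have h2 : Real.log ((N / x : ℕ) : ℝ) ≤ Real.log N - Real.log x := by
      rw [← Real.log_div hN0.ne' hx0.ne']
      exact Real.log_le_log hq0 Nat.cast_div_le
    linarith
  refine hstep1.trans ?_
  have hsplit : ∑ x ∈ Icc 1 N, a x * (1 + (Real.log N - Real.log x)) =
      ∑ x ∈ Icc 1 N, a x + ∑ x ∈ Icc 1 N, a x * (Real.log N - Real.log x) := by
    rw [← sum_add_distrib]; refine sum_congr rfl fun x _ => by ring
  rw [hsplit]
  -- step 2: summation by parts against `F = log`
  have hparts := sum_mul_sub_eq_abel a (fun n => Real.log n) N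
  rw [hparts]
  -- step 3: `A(n)(log(n+1) − log n) ≤ ((6/π²) log n + 22)/n`
  have hstep3 : ∑ n ∈ Ico 1 N, (∑ x ∈ Icc 1 n, a x) * (Real.log ((n + 1 : ℕ) : ℝ) - Real.log n) ≤
      ∑ n ∈ Ico 1 N, (6 / Real.pi ^ 2 * (Real.log n / n) + 22 * (1 / (n : ℝ))) := by
    refine sum_le_sum fun n hn => ?_
    rw [mem_Ico] at hn
    have hn0 : (0 : ℝ) < n := by exact_mod_cast hn.1
    have hdiff : Real.log ((n + 1 : ℕ) : ℝ) - Real.log n ≤ 1 / n := by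
      push_cast
      have h := Real.log_le_sub_one_of_pos (show (0 : ℝ) < ((n : ℝ) + 1) / n by positivity)
      rw [Real.log_div (by positivity) hn0.ne'] at h
      have : ((n : ℝ) + 1) / n - 1 = 1 / n := by field_simp; ring
      linarith
    have hdiff0 : 0 ≤ Real.log ((n + 1 : ℕ) : ℝ) - Real.log n := by
      rw [sub_nonneg]; exact Real.log_le_log hn0 (by push_cast; linarith)
    have hAn := hA n hn.1
    have hAn0 : 0 ≤ ∑ x ∈ Icc 1 n, a x := sum_nonneg fun x _ => ha0 x
    have hlogn : 0 ≤ Real.log n := Real.log_nonneg (by exact_mod_cast hn.1)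
    calc (∑ x ∈ Icc 1 n, a x) * (Real.log ((n + 1 : ℕ) : ℝ) - Real.log n)
        ≤ (6 / Real.pi ^ 2 * Real.log n + 22) * (1 / n) := by
          exact mul_le_mul hAn hdiff hdiff0 (by positivity)
      _ = 6 / Real.pi ^ 2 * (Real.log n / n) + 22 * (1 / (n : ℝ)) := by ring
  refine (add_le_add (hA N hN) hstep3).trans ?_
  rw [sum_add_distrib, ← mul_sum, ← mul_sum]
  -- step 4: the two elementary sums over `1 ≤ n < N`
  have hIco : Ico 1 N ⊆ Icc 1 N := fun n hn => by
    rw [mem_Ico] at hn; rw [mem_Icc]; omega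
  have hS1 : ∑ n ∈ Ico 1 N, Real.log n / n ≤ Real.log N ^ 2 / 2 + 1 := by
    refine le_trans ?_ (sum_log_div_le N)
    refine sum_le_sum_of_subset_of_nonneg hIco fun n hn _ => ?_
    rw [mem_Icc] at hn
    have : 0 ≤ Real.log n := Real.log_nonneg (by exact_mod_cast hn.1)
    positivity
  have hS2 : ∑ n ∈ Ico 1 N, 1 / (n : ℝ) ≤ 1 + Real.log N := by
    have h := harmonic_le_one_add_log N
    rw [AverageOrder.harmonic_eq_sum_Icc_real] at h
    exact le_trans (sum_le_sum_of_subset_of_nonneg hIco fun n _ _ => by positivity) h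
  have hπ : 0 < Real.pi ^ 2 := by positivity
  have hπ9 : 9 < Real.pi ^ 2 := by have := Real.pi_gt_three; nlinarith
  have hc : 6 / Real.pi ^ 2 < 1 := by rw [div_lt_one hπ]; linarith
  have hc0 : 0 < 6 / Real.pi ^ 2 := by positivity
  have e3 : 3 / Real.pi ^ 2 = 6 / Real.pi ^ 2 / 2 := by ring
  rw [e3]
  nlinarith [mul_le_mul_of_nonneg_left hS1 hc0.le]

end Literature.NumberTheory.Multiplicative.SquarefreeHarmonic
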